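import Summits.BirchSwinnertonDyer.BirchSwinnertonDyer.Theorems.ResidualThetaTransportAtTwoThetaLayerLambdaCongruenceAtTwoCuspSpanConjugation
import HarnessLib

/-!
# Route `ResidualThetaTransportAtTwo`, node (G′)_N = `CuspSpanEvenAtTwo N` (item 27436, cruxes Kan⁺ 20688 / Kμ⁺ 20689 / 21437):
# the node at level `N` from ARITHMETIC WITNESSES — one left parabolic move `T^j` plus the lead's conjugation criterion

Cell `bsd-wall`, extra width seat `bsd-wall-rtt-p3-w5` g0 (2026-08-28). THEOREMS ONLY (no `def`, no `sorry`, no named fact);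
`--supports stmt-BirchSwinnertonDyer-20688`; BSD is not proved by this. This is the first half of the seat's check of
`Cruxes/ThetaLayerLambdaCongruenceAtTwo/Lines/birth-generation.md` §4.2 (lead g9: «to be checked line by line by the next seat»).

Setting: `χ : Γ₀(N) → ZMod 2` additive, killing the elements of trace `0, ±1, ±2` and every `γ` with `|d(γ)| = 4^k`, `k ≥ 1`
(hypotheses of the trace form (G″)_N). For `γ = (a b; Nc' d) ∈ Γ₀(N)` and an integer `j` put `a_j := a + jNc'` (the upper-left
entry of `T^j γ`, `T = (1 1; 0 1)`).

* §1 `chi_eq_zero_of_divisor_witness` — **DIVISOR FORM of the conjugation criterion, after a `T`-move**: if for some integers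
  `j, t` and some `k ≥ 1` the integer `N·(c' + t·a_j)` divides `a_j·4^k − 1`, then `χ γ = 0`. (With `q := c' + t a_j` — any integer
  `≡ c' (mod a_j)` — the hypothesis reads `N q ∣ a_j 4^k − 1`; then `m := (4^k − d − tN b_j)/(Nq)` is an integer because
  `a_j (4^k − d − tNb_j) = (a_j4^k − 1) − b_j·Nq` and `gcd(a_j, Nq) = 1`, and the lead's `chi_eq_zero_of_conj_witness` (p626263) applies to
  `T^j γ`: `T_m⁻¹ L_t T^j γ T_m` has lower-right entry exactly `4^k`.)
* §2 `exists_mulChar_of_forall_gamma1` — bookkeeping: an additive `χ` killing `Γ₁'(N) = {d ≡ 1 (mod N)}` is `ψ ∘ d̄` with `ψ`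
  multiplicative on units (the fibre argument of rtt-p4-w3's `cuspSpanTrace_of_gamma1_le_closure`, isolated).
* §3 `cuspSpanTrace_of_witnesses` / **`cuspSpanEvenAtTwo_of_witnesses`** — if EVERY pair `(a, c')` with `gcd(a, Nc') = 1`,
  `a ≡ 1 (mod N)`, `c' ≠ 0` admits such a witness `(j, t, k)`, then (G″)_N and the named node `CuspSpanEvenAtTwo N` hold
  (only the classes `d ≡ 1 (mod N)` have to be killed; there `a ≡ 1` and `ε = +1`).

The witness hypothesis is a statement of elementary number theory («some `a_j 4^k − 1` has a divisor `N q` with `q ≡ c' (mod a_j)`»);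
the sequel `…CuspSpanArtinReduction` derives it at EVERY odd level from Artin's primitive-root conjecture for the base `2` in
arithmetic progressions `≡ 3 (mod 8)` (Hooley 1967 / Lenstra 1977 / Moree 1999: a theorem under GRH). Nothing here is conditional.

References: H. Rademacher, *Über die Erzeugenden von Kongruenzuntergruppen der Modulgruppe*, Abh. Math. Sem. Hamburg 7 (1929) §1
[Rademacher1929]; A. W. Knapp, *Elliptic curves* (1992) Prop. 11.22 [Knapp1993]; R. Pollack, Duke Math. J. 118 (2003) Conj. 6.3 [Pollack2003].
-/

set_option autoImplicit false
set_option linter.dupNamespace false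

noncomputable section

open scoped Classical MatrixGroups

open CongruenceSubgroup

namespace Summit.BirchSwinnertonDyer.BirchSwinnertonDyer.Theorems.SignedMuAtTwo

/-! ## §1. The divisor form of the conjugation criterion after one `T`-move -/

section Divisor

variable {N : ℕ} {χ : Gamma0 N → ZMod 2}

/-- **Divisor-form witness ⟹ `χ γ = 0`.** For additive `χ` killing the small-trace elements and the `4^k`-classes, and
`γ = (a b; c d) ∈ Γ₀(N)` with `c = N c'`: if `N·(c' + t·(a + jNc')) ∣ (a + jNc')·4^k − 1` for some integers `j, t` and some `k ≥ 1`,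
then `χ γ = 0`. Proof: pass to `T^j γ = (a + jc, b + jd; c, d)` (`χ(T^j) = 0`), then apply the conjugation criterion
`chi_eq_zero_of_conj_witness` with this `t` and `m := (4^k − d − tN(b + jd))/(N(c' + t(a + jNc')))`, an integer since
`(a + jNc')·(4^k − d − tN(b+jd)) = ((a + jNc')4^k − 1) − (b + jd)·N(c' + t(a + jNc'))` and `a + jNc'` is prime to the divisor.
[cite: Rademacher1929, §1] -/
theorem chi_eq_zero_of_divisor_witness
    (hadd : ∀ γ δ : Gamma0 N, χ (γ * δ) = χ γ + χ δ)
    (hsmall : ∀ γ : Gamma0 N, ((γ : SL(2, ℤ)) 0 0 + (γ : SL(2, ℤ)) 1 1).natAbs ≤ 2 → χ γ = 0)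
    (hkill : ∀ γ : Gamma0 N, (∃ k : ℕ, 1 ≤ k ∧ ((γ : SL(2, ℤ)) 1 1).natAbs = 4 ^ k) → χ γ = 0)
    (γ : Gamma0 N) (c' : ℤ) (hc : (γ : SL(2, ℤ)) 1 0 = N * c') (j t : ℤ) (k : ℕ) (hk : 1 ≤ k)
    (hdiv : (N : ℤ) * (c' + t * ((γ : SL(2, ℤ)) 0 0 + j * N * c')) ∣ ((γ : SL(2, ℤ)) 0 0 + j * N * c') * 4 ^ k - 1) :
    χ γ = 0 := by
  -- names for the entries and the determinant
  set a : ℤ := (γ : SL(2, ℤ)) 0 0 with ha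
  set b : ℤ := (γ : SL(2, ℤ)) 0 1 with hb
  set d : ℤ := (γ : SL(2, ℤ)) 1 1 with hd
  have hdet : a * d - b * (N * c') = 1 := by
    have h := Matrix.det_fin_two (γ : SL(2, ℤ)).1
    rw [(γ : SL(2, ℤ)).2] at h
    rw [ha, hb, hd, ← hc]
    exact h.symm
  -- the parabolic `T^j = (1 j; 0 1)`
  obtain ⟨Tj, hT00, hT01, hT10, hT11⟩ :=
    ThetaLayerLambdaCongruenceAtTwo.exists_gamma0_entries (N := N) 1 j 0 1 (by ring) (dvd_zero _)
  have hTj : χ Tj = 0 := hsmall Tj (by rw [hT00, hT11]; rfl)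
  -- entries of `γ' := T^j γ`
  have h00 : ((Tj * γ : Gamma0 N) : SL(2, ℤ)) 0 0 = a + j * N * c' := by
    rw [gamma0_mul_apply_zero_zero', hT00, hT01, hc]; ring
  have h01 : ((Tj * γ : Gamma0 N) : SL(2, ℤ)) 0 1 = b + j * d := by
    rw [gamma0_mul_apply_zero_one, hT00, hT01]; ring
  have h10 : ((Tj * γ : Gamma0 N) : SL(2, ℤ)) 1 0 = N * c' := by
    rw [ThetaLayerLambdaCongruenceAtTwo.gamma0_mul_apply_one_zero, hT10, hT11, hc]; ring
  have h11 : ((Tj * γ : Gamma0 N) : SL(2, ℤ)) 1 1 = d := by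
    rw [gamma0_mul_apply_one_one', hT10, hT11]; ring
  -- the integer `m`
  set a' : ℤ := a + j * N * c' with ha'
  set b' : ℤ := b + j * d with hb'
  set q : ℤ := c' + t * a' with hq
  have hdet' : a' * d - b' * (N * c') = 1 := by rw [ha', hb']; linear_combination hdet
  have hcop : IsCoprime ((N : ℤ) * q) a' := by
    have h1 : IsCoprime a' ((N : ℤ) * c') := ⟨d, -b', by linear_combination hdet'⟩
    have h2 : IsCoprime a' ((N : ℤ) * c' + a' * (N * t)) := h1.add_mul_left_right _
    have h3 : (N : ℤ) * c' + a' * (N * t) = N * q := by rw [hq]; ring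
    rw [h3] at h2
    exact h2.symm
  have hmul : (N : ℤ) * q ∣ a' * (4 ^ k - d - t * N * b') := by
    have e : a' * (4 ^ k - d - t * N * b') = (a' * 4 ^ k - 1) - b' * (N * q) := by
      rw [hq]; linear_combination -hdet'
    rw [e]
    exact dvd_sub hdiv (dvd_mul_left _ _)
  obtain ⟨m, hm⟩ := hcop.dvd_of_dvd_mul_left hmul
  -- apply the conjugation criterion to `T^j γ`
  have hγ' : χ (Tj * γ) = 0 := by
    refine chi_eq_zero_of_conj_witness hadd hsmall hkill (Tj * γ) t m k hk 1 (by rfl) ?_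
    rw [h00, h01, h10, h11, one_mul]
    have e1 : (N : ℤ) * c' + t * N * (a + j * N * c') = N * q := by rw [hq, ha']; ring
    rw [e1, mul_comm m, ← hm, hb']
    ring
  exact chi_eq_zero_of_mul_left hadd hγ' hTj

end Divisor

/-! ## §2. An additive `χ` killing `Γ₁'(N)` is `ψ ∘ d̄` -/

section Fibre

variable {N : ℕ} [NeZero N] {χ : Gamma0 N → ZMod 2}

/-- **Fibre bookkeeping.** If `χ : Γ₀(N) → ZMod 2` is additive and kills every `γ` with `d(γ) ≡ 1 (mod N)` (Mathlib's
`Gamma1' N`), then `χ = ψ ∘ d̄` for a `ψ : ZMod N → ZMod 2` multiplicative on units: `χ` is constant on the fibres of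
`d̄ : Γ₀(N) → (ℤ/N)ˣ` (`δ⁻¹γ ∈ Γ₁'(N)` when `d̄(γ) = d̄(δ)`), `d̄` is onto the units (`exists_gamma0_cast_apply_one_one_eq`), and `ψ` is
the common value (rtt-p4-w3's argument in `cuspSpanTrace_of_gamma1_le_closure`, isolated for reuse). [cite: Knapp1993, Prop. 11.22] -/
theorem exists_mulChar_of_forall_gamma1
    (hadd : ∀ γ δ : Gamma0 N, χ (γ * δ) = χ γ + χ δ)
    (h1 : ∀ γ : Gamma0 N, γ ∈ Gamma1' N → χ γ = 0) :
    ∃ ψ : ZMod N → ZMod 2, (∀ x y : ZMod N, IsUnit x → IsUnit y → ψ (x * y) = ψ x + ψ y) ∧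
      ∀ γ : Gamma0 N, χ γ = ψ ((((γ : SL(2, ℤ)) 1 1 : ℤ) : ZMod N)) := by
  -- `χ` is constant on the fibres of `d̄`
  have hdep : ∀ γ δ : Gamma0 N,
      ((((γ : SL(2, ℤ)) 1 1 : ℤ) : ZMod N)) = ((((δ : SL(2, ℤ)) 1 1 : ℤ) : ZMod N)) → χ γ = χ δ := by
    intro γ δ h
    have hmem : δ⁻¹ * γ ∈ Gamma1' N := by
      rw [Gamma1_mem']
      change ((((δ⁻¹ * γ : Gamma0 N) : SL(2, ℤ)) 1 1 : ℤ) : ZMod N) = 1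
      rw [cast_mul_apply_one_one, coe_inv_apply_one_one, h, mul_comm]
      exact gamma0_apply_one_one_mul_apply_zero_zero δ
    have h0 := h1 _ hmem
    rw [hadd, map_inv_eq_of_additive hadd] at h0
    have : χ γ = -χ δ := by linear_combination h0
    rw [this, ZMod.neg_eq_self_mod_two]
  refine ⟨fun x ↦ if h : ∃ γ : Gamma0 N, ((((γ : SL(2, ℤ)) 1 1 : ℤ) : ZMod N)) = x then χ h.choose else 0, ?_, ?_⟩
  · have hval : ∀ γ : Gamma0 N,
        (fun x : ZMod N ↦ if h : ∃ γ : Gamma0 N, ((((γ : SL(2, ℤ)) 1 1 : ℤ) : ZMod N)) = x then χ h.choose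
          else 0) ((((γ : SL(2, ℤ)) 1 1 : ℤ) : ZMod N)) = χ γ := by
      intro γ
      have hex : ∃ γ' : Gamma0 N, ((((γ' : SL(2, ℤ)) 1 1 : ℤ) : ZMod N)) = ((((γ : SL(2, ℤ)) 1 1 : ℤ) : ZMod N)) :=
        ⟨γ, rfl⟩
      simp only [dif_pos hex]
      exact hdep _ _ hex.choose_spec
    intro x y hx hy
    obtain ⟨γx, hγx⟩ := exists_gamma0_cast_apply_one_one_eq hx
    obtain ⟨γy, hγy⟩ := exists_gamma0_cast_apply_one_one_eq hy
    rw [← hγx, ← hγy, ← cast_mul_apply_one_one, hval, hval, hval, hadd]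
  · intro γ
    have hex : ∃ γ' : Gamma0 N, ((((γ' : SL(2, ℤ)) 1 1 : ℤ) : ZMod N)) = ((((γ : SL(2, ℤ)) 1 1 : ℤ) : ZMod N)) :=
      ⟨γ, rfl⟩
    simp only [dif_pos hex]
    exact (hdep _ _ hex.choose_spec).symm

end Fibre

/-! ## §3. Witnesses at every class `d ≡ 1 (mod N)` ⟹ (G″)_N ⟹ `CuspSpanEvenAtTwo N` -/

section Witnesses

variable {N : ℕ} [NeZero N]

/-- **(G″)_N from arithmetic witnesses.** Suppose that for all integers `a, c'` with `gcd(a, N c') = 1`, `a ≡ 1 (mod N)` and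
`c' ≠ 0` there are integers `j, t` and `k ≥ 1` with `N·(c' + t(a + jNc')) ∣ (a + jNc')·4^k − 1`. Then every additive
`χ : Γ₀(N) → ZMod 2` killing the elements of trace `0, ±1, ±2` and the `4^k`-classes is `ψ ∘ d̄` with `ψ` multiplicative on units:
such a `χ` kills every `γ ∈ Γ₁'(N)` (`c' = 0` ⟹ `γ = ±T^b` has trace `±2`; otherwise §1 with `a(γ) ≡ d(γ)⁻¹ ≡ 1`), then §2.
[cite: Knapp1993, Prop. 11.22] [cite: Pollack2003, Conj. 6.3] -/
theorem cuspSpanTrace_of_witnesses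
    (hW : ∀ a c' : ℤ, IsCoprime a ((N : ℤ) * c') → (N : ℤ) ∣ a - 1 → c' ≠ 0 →
      ∃ j t : ℤ, ∃ k : ℕ, 1 ≤ k ∧ (N : ℤ) * (c' + t * (a + j * N * c')) ∣ (a + j * N * c') * 4 ^ k - 1) :
    ∀ χ : Gamma0 N → ZMod 2,
      (∀ γ δ : Gamma0 N, χ (γ * δ) = χ γ + χ δ) →
      (∀ γ : Gamma0 N, ((γ : SL(2, ℤ)) 0 0 + (γ : SL(2, ℤ)) 1 1).natAbs ≤ 2 → χ γ = 0) →
      (∀ γ : Gamma0 N, (∃ k : ℕ, 1 ≤ k ∧ ((γ : SL(2, ℤ)) 1 1).natAbs = 4 ^ k) → χ γ = 0) →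
      ∃ ψ : ZMod N → ZMod 2, (∀ x y : ZMod N, IsUnit x → IsUnit y → ψ (x * y) = ψ x + ψ y) ∧
        ∀ γ : Gamma0 N, χ γ = ψ ((((γ : SL(2, ℤ)) 1 1 : ℤ) : ZMod N)) := by
  intro χ hadd hsmall hkill
  refine exists_mulChar_of_forall_gamma1 hadd fun γ hγ ↦ ?_
  -- entries
  set a : ℤ := (γ : SL(2, ℤ)) 0 0 with ha
  set b : ℤ := (γ : SL(2, ℤ)) 0 1 with hb
  set c : ℤ := (γ : SL(2, ℤ)) 1 0 with hc
  set d : ℤ := (γ : SL(2, ℤ)) 1 1 with hd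
  have hdet : a * d - b * c = 1 := by
    have h := Matrix.det_fin_two (γ : SL(2, ℤ)).1
    rw [(γ : SL(2, ℤ)).2] at h
    exact h.symm
  -- `c = N c'`
  have hcN : (N : ℤ) ∣ c := by
    have h := γ.2
    rw [Gamma0_mem] at h
    exact (ZMod.intCast_zmod_eq_zero_iff_dvd _ N).mp (by exact_mod_cast h)
  obtain ⟨c', hc'⟩ := hcN
  -- `a ≡ 1 (mod N)`: `d̄ = 1` and `d̄ ā = 1`
  have hd1 : ((d : ℤ) : ZMod N) = 1 := by
    have h := hγ
    rw [Gamma1_mem'] at h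
    exact h
  have ha1 : (N : ℤ) ∣ a - 1 := by
    have h := gamma0_apply_one_one_mul_apply_zero_zero γ
    rw [← hd, ← ha, hd1, one_mul] at h
    have : ((a - 1 : ℤ) : ZMod N) = 0 := by push_cast; rw [h, sub_self]
    exact (ZMod.intCast_zmod_eq_zero_iff_dvd _ N).mp this
  by_cases hc0 : c' = 0
  · -- `c = 0`: `γ = ±T^b`, trace `±2`
    apply hsmall
    have hc00 : c = 0 := by rw [hc', hc0, mul_zero]
    rw [hc00, mul_zero, sub_zero] at hdet
    rcases Int.eq_one_or_neg_one_of_mul_eq_one hdet with h1 | h1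
    · have hd' : d = 1 := by rw [h1, one_mul] at hdet; exact hdet
      rw [← ha, ← hd, h1, hd']; rfl
    · have hd' : d = -1 := by rw [h1] at hdet; linear_combination -hdet
      rw [← ha, ← hd, h1, hd']; rfl
  · have hcop : IsCoprime a ((N : ℤ) * c') := ⟨d, -b, by rw [← hc']; linear_combination hdet⟩
    obtain ⟨j, t, k, hk, hdiv⟩ := hW a c' hcop ha1 hc0
    exact chi_eq_zero_of_divisor_witness hadd hsmall hkill γ c' hc' j t k hk hdiv

/-- **`CuspSpanEvenAtTwo N` from arithmetic witnesses** (the named node (G′)_N at level `N`): the previous theorem followed by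
rtt-p4-w3's `cuspSpanEvenAtTwo_of_cuspSpanTrace`. The witness hypothesis («for `gcd(a, Nc') = 1`, `a ≡ 1 (mod N)`, `c' ≠ 0`:
some `(a + jNc')·4^k − 1`, `k ≥ 1`, is divisible by `N q` for some integer `q ≡ c' (mod a + jNc')`») is derived at every odd `N`
from Artin's conjecture for `2` in progressions `≡ 3 (mod 8)` in the sequel. [cite: Pollack2003, Conj. 6.3] [cite: Knapp1993, Prop. 11.22] -/
theorem cuspSpanEvenAtTwo_of_witnesses
    (hW : ∀ a c' : ℤ, IsCoprime a ((N : ℤ) * c') → (N : ℤ) ∣ a - 1 → c' ≠ 0 →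
      ∃ j t : ℤ, ∃ k : ℕ, 1 ≤ k ∧ (N : ℤ) * (c' + t * (a + j * N * c')) ∣ (a + j * N * c') * 4 ^ k - 1) :
    CuspSpanEvenAtTwo N :=
  cuspSpanEvenAtTwo_of_cuspSpanTrace (cuspSpanTrace_of_witnesses hW)

end Witnesses

end Summit.BirchSwinnertonDyer.BirchSwinnertonDyer.Theorems.SignedMuAtTwo

end
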